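import Summits.BirchSwinnertonDyer.BirchSwinnertonDyer.Theorems.ResidualThetaTransportAtTwoThetaLayerLambdaCongruenceAtTwoHeckeAdjointSweepReps
import HarnessLib

/-!
# Crux `ThetaLayerLambdaCongruenceAtTwo` (stmt-BirchSwinnertonDyer-20688, route ResidualThetaTransportAtTwo), line
# `birth` v14 — SD floor, kernel road, Hecke clause of IP, brick HA8b (part 2) «SWEEP»: the dual-side sum `Σ_i Σᶠ_{u∈Γ₀(N)} Φ(u·M_i)`
# over the representatives `M_i` of `T_p`/`U_p` and the Manin-side sum `Σ_j Σᶠ_{u∈Γ₀(N)} Φ(adj(M̃_j)·u)` over the transposed representatives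
# are the SAME sum `Σᶠ_{A ∈ S_p(N)} Φ(A)` (lead prover bsd-wall-rtt-p3 g13; `--supports stmt-BirchSwinnertonDyer-20688 --as helper`;
# closes nothing)

HONEST FRAMING. Elementary THEOREMS about `2×2` integer matrices and finitely supported sums; no definition; nothing about any curve or
form is asserted; BSD is not proved by any of this.

WHAT. With `S_p(N) = {A ∈ M₂(ℤ) : det A = p, N ∣ A₁₀, IsCoprime A₀₀ N}` and the two bijections of part 1 (`…HeckeAdjointSweepReps`):
* §1 the remaining injectivity facts of the right sweep (`lowB_mul_ne_tpD_mul`, `tpD_mul_inj`);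
* §2 `range_mul_tpB_eq` / `range_lowB_mul_eq` (`p ∣ N`, index `Fin p`) and `range_mul_rep_eq` / `range_rep_mul_eq` (`p ∤ N`, index
  `Option (Fin p)`, `none ↦ (p 0; 0 1)` — the index conventions of w4 g7's HA8a `…HeckeAdjointHeckeCocycle`): both parametrisations have range
  `S_p(N)` and are injective;
* §3 **`sum_finsum_mul_tpB_eq_sum_finsum_lowB_mul`** (`p ∣ N`) and **`sum_finsum_mul_rep_eq_sum_finsum_rep_mul`** (`p ∤ N`): for EVERY
  `Φ : M₂(ℤ) → A` (any `AddCommMonoid`; no finiteness needed — both sides are re-indexings of `Σᶠ_{A ∈ S_p(N)} Φ A` through injective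
  parametrisations, `finsum_mem_range`): `Σ_i Σᶠ_{u : Γ₀(N)} Φ(u·M_i) = Σ_i Σᶠ_{u : Γ₀(N)} Φ(M'_i·u)` with `M' (some j) = (1 0; Nj p) = adj(w_N (1 j; 0 p) w_N⁻¹)`,
  `M' none = (p 0; 0 1)`, provided each inner sum has finite support (automatic for the Hecke-clause integrand by HA3/HA5c). This is the
  «double-coset sweep» of memo §3 (C)/(D): after HA1–HA3 the dual side of `B(T_p•x) y` is such a left sum, after HA4–HA7b the Manin side of
  `B(x, T♯_p y)` is such a right sum, with the same `Φ(A) = Σ_{g ∈ L(γ')} [s(g⁻¹Aγ) − s(g⁻¹A)]`.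

References: [Shimura1971] §3.3, Prop. 3.36; [DiamondShurman2005] §5.2; [Merel1994] §1.2–1.3.
-/

set_option autoImplicit false

noncomputable section

-- justification: the `Summit.BirchSwinnertonDyer.BirchSwinnertonDyer.…` path repeats a component (route-file convention)
set_option linter.dupNamespace false

open scoped Classical MatrixGroups

open CongruenceSubgroup Matrix.SpecialLinearGroup ModularGroup
open Literature.NumberTheory.EllipticCurves.ModularForms

namespace Summit.BirchSwinnertonDyer.BirchSwinnertonDyer.Theorems.ThetaLayerLambdaCongruenceAtTwo

/-! ## §1. Right sweep: the remaining injectivity facts -/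

section RightInj

variable {N : ℕ} [NeZero N] {p : ℕ}

/-- **The two kinds of right cosets are disjoint**: `(1 0; Nj p)·u ≠ (p 0; 0 1)·u'`. [cite: Shimura1971, Prop. 3.36] -/
theorem lowB_mul_ne_tpD_mul (hp : p.Prime) (u u' : Gamma0 N) (j : Fin p) :
    !![1, 0; (N : ℤ) * ((j : ℕ) : ℤ), (p : ℤ)] * ((u : SL(2, ℤ)) : Matrix (Fin 2) (Fin 2) ℤ) ≠
      !![(p : ℤ), 0; 0, 1] * ((u' : SL(2, ℤ)) : Matrix (Fin 2) (Fin 2) ℤ) := by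
  intro h
  obtain ⟨v, hv⟩ := exists_gamma0_coe_eq_psi u
  obtain ⟨v', hv'⟩ := exists_gamma0_coe_eq_psi u'
  have hL : (!![1, 0; (N : ℤ) * ((j : ℕ) : ℤ), (p : ℤ)] : Matrix (Fin 2) (Fin 2) ℤ) 1 0 = (N : ℤ) * ((j : ℕ) : ℤ) := by simp
  have hD : (!![(p : ℤ), 0; 0, 1] : Matrix (Fin 2) (Fin 2) ℤ) 1 0 = (N : ℤ) * 0 := by simp
  have e := congrArg (fun X : Matrix (Fin 2) (Fin 2) ℤ ↦ (!![X 0 0, X 1 0 / (N : ℤ); (N : ℤ) * X 0 1, X 1 1] : Matrix (Fin 2) (Fin 2) ℤ)) h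
  rw [psi_mul _ _ ⟨_, hL⟩ (dvd_apply_one_zero u), psi_mul _ _ ⟨_, hD⟩ (dvd_apply_one_zero u'), ← hv, ← hv',
    psi_eq_of_apply_one_zero _ _ hL, psi_eq_of_apply_one_zero _ _ hD] at e
  have e' : ((v : SL(2, ℤ)) : Matrix (Fin 2) (Fin 2) ℤ) * !![1, ((j : ℕ) : ℤ); 0, (p : ℤ)] =
      ((v' : SL(2, ℤ)) : Matrix (Fin 2) (Fin 2) ℤ) * !![(p : ℤ), 0; 0, 1] := by
    convert e using 2 <;> (ext i k; fin_cases i <;> fin_cases k <;> simp)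
  exact mul_tpB_ne_mul_tpD hp _ _ j e'

omit [NeZero N] in
/-- **Injectivity of the extra right coset**: `(p 0; 0 1)·u = (p 0; 0 1)·u' ⇒ u = u'`. [folklore] -/
theorem tpD_mul_inj (hp : p.Prime) {u u' : Gamma0 N}
    (h : !![(p : ℤ), 0; 0, 1] * ((u : SL(2, ℤ)) : Matrix (Fin 2) (Fin 2) ℤ) = !![(p : ℤ), 0; 0, 1] * ((u' : SL(2, ℤ)) : Matrix (Fin 2) (Fin 2) ℤ)) :
    u = u' := by
  have hp0 : (p : ℤ) ≠ 0 := by exact_mod_cast hp.ne_zero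
  have hent : ∀ U : Matrix (Fin 2) (Fin 2) ℤ, (!![(p : ℤ), 0; 0, 1] * U) 0 0 = p * U 0 0 ∧ (!![(p : ℤ), 0; 0, 1] * U) 0 1 = p * U 0 1 ∧
      (!![(p : ℤ), 0; 0, 1] * U) 1 0 = U 1 0 ∧ (!![(p : ℤ), 0; 0, 1] * U) 1 1 = U 1 1 := fun U ↦ by
    refine ⟨?_, ?_, ?_, ?_⟩ <;> simp [Matrix.mul_apply, Fin.sum_univ_two]
  obtain ⟨a1, a2, a3, a4⟩ := hent ((u : SL(2, ℤ)) : Matrix (Fin 2) (Fin 2) ℤ)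
  obtain ⟨b1, b2, b3, b4⟩ := hent ((u' : SL(2, ℤ)) : Matrix (Fin 2) (Fin 2) ℤ)
  have e00 : (p : ℤ) * (u : SL(2, ℤ)) 0 0 = p * (u' : SL(2, ℤ)) 0 0 := by rw [← a1, ← b1, h]
  have e01 : (p : ℤ) * (u : SL(2, ℤ)) 0 1 = p * (u' : SL(2, ℤ)) 0 1 := by rw [← a2, ← b2, h]
  have e10 : (u : SL(2, ℤ)) 1 0 = (u' : SL(2, ℤ)) 1 0 := by rw [← a3, ← b3, h]
  have e11 : (u : SL(2, ℤ)) 1 1 = (u' : SL(2, ℤ)) 1 1 := by rw [← a4, ← b4, h]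
  refine Subtype.ext (Subtype.ext ?_)
  ext i k
  fin_cases i <;> fin_cases k
  · exact mul_left_cancel₀ hp0 e00
  · exact mul_left_cancel₀ hp0 e01
  · exact e10
  · exact e11

end RightInj

/-! ## §2. Both parametrisations have range `S_p(N)` -/

section Ranges

variable {N : ℕ} [NeZero N] {p : ℕ}

omit [NeZero N] in
/-- **Range of the left sweep, `p ∣ N`**: `{u·(1 j; 0 p)} = S_p(N)`. [cite: Shimura1971, Prop. 3.36] -/
theorem range_mul_tpB_eq (hp : p.Prime) (hpN : p ∣ N) :
    Set.range (fun x : Fin p × Gamma0 N ↦ ((x.2 : SL(2, ℤ)) : Matrix (Fin 2) (Fin 2) ℤ) * !![1, ((x.1 : ℕ) : ℤ); 0, (p : ℤ)]) =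
      {A : Matrix (Fin 2) (Fin 2) ℤ | A.det = p ∧ (N : ℤ) ∣ A 1 0 ∧ IsCoprime (A 0 0) (N : ℤ)} := by
  ext A
  constructor
  · rintro ⟨⟨j, u⟩, rfl⟩
    exact gamma0_mul_tpB_mem u _
  · rintro ⟨hdet, hc, ha⟩
    obtain ⟨u, hu⟩ := exists_gamma0_mul_rep hp A hdet hc ha
    rcases hu with ⟨j, hj⟩ | ⟨hpN', -⟩
    · exact ⟨⟨j, u⟩, hj.symm⟩
    · exact absurd hpN hpN'

/-- **Range of the right sweep, `p ∣ N`**: `{(1 0; Nj p)·u} = S_p(N)`. [cite: Shimura1971, Prop. 3.36] -/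
theorem range_lowB_mul_eq (hp : p.Prime) (hpN : p ∣ N) :
    Set.range (fun x : Fin p × Gamma0 N ↦ !![1, 0; (N : ℤ) * ((x.1 : ℕ) : ℤ), (p : ℤ)] * ((x.2 : SL(2, ℤ)) : Matrix (Fin 2) (Fin 2) ℤ)) =
      {A : Matrix (Fin 2) (Fin 2) ℤ | A.det = p ∧ (N : ℤ) ∣ A 1 0 ∧ IsCoprime (A 0 0) (N : ℤ)} := by
  ext A
  constructor
  · rintro ⟨⟨j, u⟩, rfl⟩
    refine ⟨?_, ?_, ?_⟩
    · rw [Matrix.det_mul, Matrix.SpecialLinearGroup.det_coe, mul_one, Matrix.det_fin_two_of]; ring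
    · simp only [Matrix.mul_apply, Fin.sum_univ_two]
      simp only [Matrix.of_apply, Matrix.cons_val', Matrix.cons_val_zero, Matrix.cons_val_one, Matrix.empty_val',
        Matrix.cons_val_fin_one]
      exact dvd_add (Dvd.dvd.mul_right (dvd_mul_right _ _) _) (Dvd.dvd.mul_left (dvd_apply_one_zero u) _)
    · simp only [Matrix.mul_apply, Fin.sum_univ_two]
      simp only [Matrix.of_apply, Matrix.cons_val', Matrix.cons_val_zero, Matrix.cons_val_one, Matrix.empty_val',
        Matrix.cons_val_fin_one, one_mul, zero_mul, add_zero]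
      exact isCoprime_apply_zero_zero u
  · rintro ⟨hdet, hc, ha⟩
    obtain ⟨u, hu⟩ := exists_rep_mul_gamma0 hp A hdet hc ha
    rcases hu with ⟨j, hj⟩ | ⟨hpN', -⟩
    · exact ⟨⟨j, u⟩, hj.symm⟩
    · exact absurd hpN hpN'

omit [NeZero N] in
/-- **Range of the left sweep, `p ∤ N`** (index `Option (Fin p)`, `none ↦ (p 0; 0 1)`): `S_p(N)`. [cite: DiamondShurman2005, §5.2] -/
theorem range_mul_rep_eq (hp : p.Prime) (hpN : ¬ p ∣ N) :
    Set.range (fun x : Option (Fin p) × Gamma0 N ↦ ((x.2 : SL(2, ℤ)) : Matrix (Fin 2) (Fin 2) ℤ) *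
      x.1.elim !![(p : ℤ), 0; 0, 1] (fun j ↦ !![1, ((j : ℕ) : ℤ); 0, (p : ℤ)])) =
      {A : Matrix (Fin 2) (Fin 2) ℤ | A.det = p ∧ (N : ℤ) ∣ A 1 0 ∧ IsCoprime (A 0 0) (N : ℤ)} := by
  ext A
  constructor
  · rintro ⟨⟨i, u⟩, rfl⟩
    cases i with
    | none => exact gamma0_mul_tpD_mem u hp hpN
    | some j => exact gamma0_mul_tpB_mem u _
  · rintro ⟨hdet, hc, ha⟩
    obtain ⟨u, hu⟩ := exists_gamma0_mul_rep hp A hdet hc ha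
    rcases hu with ⟨j, hj⟩ | ⟨-, hD⟩
    · exact ⟨⟨some j, u⟩, hj.symm⟩
    · exact ⟨⟨none, u⟩, hD.symm⟩

/-- **Range of the right sweep, `p ∤ N`** (`none ↦ (p 0; 0 1)`, `some j ↦ (1 0; Nj p)`): `S_p(N)`. [cite: DiamondShurman2005, §5.2] -/
theorem range_rep_mul_eq (hp : p.Prime) (hpN : ¬ p ∣ N) :
    Set.range (fun x : Option (Fin p) × Gamma0 N ↦
      x.1.elim !![(p : ℤ), 0; 0, 1] (fun j ↦ !![1, 0; (N : ℤ) * ((j : ℕ) : ℤ), (p : ℤ)]) * ((x.2 : SL(2, ℤ)) : Matrix (Fin 2) (Fin 2) ℤ)) =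
      {A : Matrix (Fin 2) (Fin 2) ℤ | A.det = p ∧ (N : ℤ) ∣ A 1 0 ∧ IsCoprime (A 0 0) (N : ℤ)} := by
  ext A
  constructor
  · rintro ⟨⟨i, u⟩, rfl⟩
    cases i with
    | none =>
      refine ⟨?_, ?_, ?_⟩
      · dsimp only [Option.elim]
        rw [Matrix.det_mul, Matrix.SpecialLinearGroup.det_coe, mul_one, Matrix.det_fin_two_of]; ring
      · dsimp only [Option.elim]
        simp only [Matrix.mul_apply, Fin.sum_univ_two]
        simp only [Matrix.of_apply, Matrix.cons_val', Matrix.cons_val_zero, Matrix.cons_val_one, Matrix.empty_val',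
          Matrix.cons_val_fin_one, zero_mul, one_mul, zero_add]
        exact dvd_apply_one_zero u
      · dsimp only [Option.elim]
        simp only [Matrix.mul_apply, Fin.sum_univ_two]
        simp only [Matrix.of_apply, Matrix.cons_val', Matrix.cons_val_zero, Matrix.cons_val_one, Matrix.empty_val',
          Matrix.cons_val_fin_one, zero_mul, add_zero]
        exact IsCoprime.mul_left (Nat.isCoprime_iff_coprime.mpr ((Nat.Prime.coprime_iff_not_dvd hp).mpr hpN))
          (isCoprime_apply_zero_zero u)
    | some j =>
      refine ⟨?_, ?_, ?_⟩
      · dsimp only [Option.elim]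
        rw [Matrix.det_mul, Matrix.SpecialLinearGroup.det_coe, mul_one, Matrix.det_fin_two_of]; ring
      · dsimp only [Option.elim]
        simp only [Matrix.mul_apply, Fin.sum_univ_two]
        simp only [Matrix.of_apply, Matrix.cons_val', Matrix.cons_val_zero, Matrix.cons_val_one, Matrix.empty_val',
          Matrix.cons_val_fin_one]
        exact dvd_add (Dvd.dvd.mul_right (dvd_mul_right _ _) _) (Dvd.dvd.mul_left (dvd_apply_one_zero u) _)
      · dsimp only [Option.elim]
        simp only [Matrix.mul_apply, Fin.sum_univ_two]
        simp only [Matrix.of_apply, Matrix.cons_val', Matrix.cons_val_zero, Matrix.cons_val_one, Matrix.empty_val',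
          Matrix.cons_val_fin_one, one_mul, zero_mul, add_zero]
        exact isCoprime_apply_zero_zero u
  · rintro ⟨hdet, hc, ha⟩
    obtain ⟨u, hu⟩ := exists_rep_mul_gamma0 hp A hdet hc ha
    rcases hu with ⟨j, hj⟩ | ⟨-, hD⟩
    · exact ⟨⟨some j, u⟩, hj.symm⟩
    · exact ⟨⟨none, u⟩, hD.symm⟩

omit [NeZero N] in
/-- Injectivity of the left sweep (`p ∣ N` indexing). [cite: Shimura1971, Prop. 3.36] -/
theorem injective_mul_tpB (hp : p.Prime) :
    Function.Injective (fun x : Fin p × Gamma0 N ↦ ((x.2 : SL(2, ℤ)) : Matrix (Fin 2) (Fin 2) ℤ) * !![1, ((x.1 : ℕ) : ℤ); 0, (p : ℤ)]) := by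
  rintro ⟨j, u⟩ ⟨j', u'⟩ h
  obtain ⟨hu, hj⟩ := mul_tpB_inj hp h
  rw [Prod.mk.injEq]
  exact ⟨hj, Subtype.ext hu⟩

/-- Injectivity of the right sweep (`p ∣ N` indexing). [cite: Shimura1971, Prop. 3.36] -/
theorem injective_lowB_mul (hp : p.Prime) :
    Function.Injective (fun x : Fin p × Gamma0 N ↦
      !![1, 0; (N : ℤ) * ((x.1 : ℕ) : ℤ), (p : ℤ)] * ((x.2 : SL(2, ℤ)) : Matrix (Fin 2) (Fin 2) ℤ)) := by
  rintro ⟨j, u⟩ ⟨j', u'⟩ h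
  obtain ⟨hu, hj⟩ := lowB_mul_inj hp h
  rw [Prod.mk.injEq]
  exact ⟨hj, hu⟩

omit [NeZero N] in
/-- Injectivity of the left sweep (`p ∤ N` indexing). [cite: DiamondShurman2005, §5.2] -/
theorem injective_mul_rep (hp : p.Prime) :
    Function.Injective (fun x : Option (Fin p) × Gamma0 N ↦ ((x.2 : SL(2, ℤ)) : Matrix (Fin 2) (Fin 2) ℤ) *
      x.1.elim !![(p : ℤ), 0; 0, 1] (fun j ↦ !![1, ((j : ℕ) : ℤ); 0, (p : ℤ)])) := by
  rintro ⟨i, u⟩ ⟨i', u'⟩ h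
  rw [Prod.mk.injEq]
  cases i with
  | none =>
    cases i' with
    | none => exact ⟨rfl, Subtype.ext (mul_tpD_inj hp h)⟩
    | some j' => exact absurd h.symm (mul_tpB_ne_mul_tpD hp _ _ j')
  | some j =>
    cases i' with
    | none => exact absurd h (mul_tpB_ne_mul_tpD hp _ _ j)
    | some j' =>
      obtain ⟨hu, hj⟩ := mul_tpB_inj hp h
      exact ⟨congrArg some hj, Subtype.ext hu⟩

/-- Injectivity of the right sweep (`p ∤ N` indexing). [cite: DiamondShurman2005, §5.2] -/
theorem injective_rep_mul (hp : p.Prime) :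
    Function.Injective (fun x : Option (Fin p) × Gamma0 N ↦
      x.1.elim !![(p : ℤ), 0; 0, 1] (fun j ↦ !![1, 0; (N : ℤ) * ((j : ℕ) : ℤ), (p : ℤ)]) * ((x.2 : SL(2, ℤ)) : Matrix (Fin 2) (Fin 2) ℤ)) := by
  rintro ⟨i, u⟩ ⟨i', u'⟩ h
  rw [Prod.mk.injEq]
  cases i with
  | none =>
    cases i' with
    | none => exact ⟨rfl, tpD_mul_inj hp h⟩
    | some j' => exact absurd h.symm (lowB_mul_ne_tpD_mul hp _ _ j')
  | some j =>
    cases i' with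
    | none => exact absurd h (lowB_mul_ne_tpD_mul hp _ _ j)
    | some j' =>
      obtain ⟨hu, hj⟩ := lowB_mul_inj hp h
      exact ⟨congrArg some hj, hu⟩

end Ranges

/-! ## §3. The sweep identities -/

section Sweep

variable {N : ℕ} [NeZero N] {p : ℕ} {A : Type*} [AddCommMonoid A]

/-- Re-indexing a `Σ Σᶠ` through an injective parametrisation: `Σ_i Σᶠ_u Φ(e(i,u)) = Σᶠ_{m ∈ range e} Φ m` when every inner sum has finite
support. [folklore] -/
theorem sum_finsum_eq_finsum_mem_range {ι : Type} [Fintype ι] {G M : Type*} (e : ι × G → M) (he : Function.Injective e) (Φ : M → A)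
    (hfin : ∀ i, (Function.support fun u : G ↦ Φ (e (i, u))).Finite) :
    ∑ i, ∑ᶠ u, Φ (e (i, u)) = ∑ᶠ m ∈ Set.range e, Φ m := by
  rw [finsum_mem_range he, ← finsum_eq_sum_of_fintype]
  have hsupp : (Function.support (Φ ∘ e)).Finite := by
    have : Function.support (Φ ∘ e) ⊆ ⋃ i, (fun u ↦ (i, u)) '' Function.support (fun u : G ↦ Φ (e (i, u))) := by
      rintro ⟨i, u⟩ hx
      exact Set.mem_iUnion.mpr ⟨i, ⟨u, hx, rfl⟩⟩
    exact (Set.finite_iUnion fun i ↦ (hfin i).image _).subset this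
  exact (finsum_curry (Φ ∘ e) hsupp).symm

/-- **SWEEP, `p ∣ N`.** For every `Φ : M₂(ℤ) → A` whose restrictions to the cosets have finite support:
`Σ_{j<p} Σᶠ_{u ∈ Γ₀(N)} Φ(u·(1 j; 0 p)) = Σ_{j<p} Σᶠ_{u ∈ Γ₀(N)} Φ((1 0; Nj p)·u)` — both equal `Σᶠ_{A ∈ S_p(N)} Φ A`.
[cite: Shimura1971, Prop. 3.36] [cite: Merel1994, §1.2–1.3] -/
theorem sum_finsum_mul_tpB_eq_sum_finsum_lowB_mul (hp : p.Prime) (hpN : p ∣ N) (Φ : Matrix (Fin 2) (Fin 2) ℤ → A)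
    (hL : ∀ j : Fin p, (Function.support fun u : Gamma0 N ↦ Φ (((u : SL(2, ℤ)) : Matrix (Fin 2) (Fin 2) ℤ) * !![1, ((j : ℕ) : ℤ); 0, (p : ℤ)])).Finite)
    (hR : ∀ j : Fin p, (Function.support fun u : Gamma0 N ↦ Φ (!![1, 0; (N : ℤ) * ((j : ℕ) : ℤ), (p : ℤ)] * ((u : SL(2, ℤ)) : Matrix (Fin 2) (Fin 2) ℤ))).Finite) :
    ∑ j : Fin p, ∑ᶠ u : Gamma0 N, Φ (((u : SL(2, ℤ)) : Matrix (Fin 2) (Fin 2) ℤ) * !![1, ((j : ℕ) : ℤ); 0, (p : ℤ)]) =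
      ∑ j : Fin p, ∑ᶠ u : Gamma0 N, Φ (!![1, 0; (N : ℤ) * ((j : ℕ) : ℤ), (p : ℤ)] * ((u : SL(2, ℤ)) : Matrix (Fin 2) (Fin 2) ℤ)) := by
  rw [sum_finsum_eq_finsum_mem_range (fun x : Fin p × Gamma0 N ↦ ((x.2 : SL(2, ℤ)) : Matrix (Fin 2) (Fin 2) ℤ) * !![1, ((x.1 : ℕ) : ℤ); 0, (p : ℤ)])
      (injective_mul_tpB hp) Φ hL,
    sum_finsum_eq_finsum_mem_range (fun x : Fin p × Gamma0 N ↦ !![1, 0; (N : ℤ) * ((x.1 : ℕ) : ℤ), (p : ℤ)] * ((x.2 : SL(2, ℤ)) : Matrix (Fin 2) (Fin 2) ℤ))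
      (injective_lowB_mul hp) Φ hR,
    range_mul_tpB_eq hp hpN, range_lowB_mul_eq hp hpN]

/-- **SWEEP, `p ∤ N`** (index `Option (Fin p)`: `some j ↦ (1 j; 0 p)` resp. `(1 0; Nj p)`, `none ↦ (p 0; 0 1)` on both sides):
`Σ_i Σᶠ_{u ∈ Γ₀(N)} Φ(u·M_i) = Σ_i Σᶠ_{u ∈ Γ₀(N)} Φ(M'_i·u)` — both equal `Σᶠ_{A ∈ S_p(N)} Φ A`.
[cite: DiamondShurman2005, §5.2] [cite: Merel1994, §1.2–1.3] -/
theorem sum_finsum_mul_rep_eq_sum_finsum_rep_mul (hp : p.Prime) (hpN : ¬ p ∣ N) (Φ : Matrix (Fin 2) (Fin 2) ℤ → A)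
    (hL : ∀ i : Option (Fin p), (Function.support fun u : Gamma0 N ↦ Φ (((u : SL(2, ℤ)) : Matrix (Fin 2) (Fin 2) ℤ) *
      i.elim !![(p : ℤ), 0; 0, 1] (fun j ↦ !![1, ((j : ℕ) : ℤ); 0, (p : ℤ)]))).Finite)
    (hR : ∀ i : Option (Fin p), (Function.support fun u : Gamma0 N ↦ Φ (i.elim !![(p : ℤ), 0; 0, 1] (fun j ↦ !![1, 0; (N : ℤ) * ((j : ℕ) : ℤ), (p : ℤ)]) *
      ((u : SL(2, ℤ)) : Matrix (Fin 2) (Fin 2) ℤ))).Finite) :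
    ∑ i : Option (Fin p), ∑ᶠ u : Gamma0 N, Φ (((u : SL(2, ℤ)) : Matrix (Fin 2) (Fin 2) ℤ) *
        i.elim !![(p : ℤ), 0; 0, 1] (fun j ↦ !![1, ((j : ℕ) : ℤ); 0, (p : ℤ)])) =
      ∑ i : Option (Fin p), ∑ᶠ u : Gamma0 N, Φ (i.elim !![(p : ℤ), 0; 0, 1] (fun j ↦ !![1, 0; (N : ℤ) * ((j : ℕ) : ℤ), (p : ℤ)]) *
        ((u : SL(2, ℤ)) : Matrix (Fin 2) (Fin 2) ℤ)) := by
  rw [sum_finsum_eq_finsum_mem_range (fun x : Option (Fin p) × Gamma0 N ↦ ((x.2 : SL(2, ℤ)) : Matrix (Fin 2) (Fin 2) ℤ) *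
      x.1.elim !![(p : ℤ), 0; 0, 1] (fun j ↦ !![1, ((j : ℕ) : ℤ); 0, (p : ℤ)])) (injective_mul_rep hp) Φ hL,
    sum_finsum_eq_finsum_mem_range (fun x : Option (Fin p) × Gamma0 N ↦
      x.1.elim !![(p : ℤ), 0; 0, 1] (fun j ↦ !![1, 0; (N : ℤ) * ((j : ℕ) : ℤ), (p : ℤ)]) * ((x.2 : SL(2, ℤ)) : Matrix (Fin 2) (Fin 2) ℤ))
      (injective_rep_mul hp) Φ hR,
    range_mul_rep_eq hp hpN, range_rep_mul_eq hp hpN]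

end Sweep

end Summit.BirchSwinnertonDyer.BirchSwinnertonDyer.Theorems.ThetaLayerLambdaCongruenceAtTwo

end
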